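import Summits.QuantumAdvantage.QuantumAdvantage.Theorems.SosSandwichQuerySecondLevelInfluence
import Summits.QuantumAdvantage.QuantumAdvantage.Theorems.SosSandwichQueryLevelDescentLine
import HarnessLib

/-!
# The `Q_T` child line of `PseudoBoundedAA`, weakened stub: descent to the TWO TOP LEVELS suffices

Support theorem for route `SosSandwich`, crux `PseudoBoundedAA` (stmt-QuantumAdvantage-15237).  File
`SosSandwichQueryLevelDescentLine` proved `LevelDescentQ ⟹ AA_Q` where the surrogate had to be one-query or
TOP-HOMOGENEOUS.  With the degree-free bound for the level below the top (`secondLevelWeight_sq_le_influence`,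
`twoTopLevels_rung_robust`) the surrogate may instead carry just a FRACTION `η` of its variance on its two highest
Walsh levels `2T' − 1`, `2T'` (`T' ≥ 2`) — a strictly weaker requirement than top-homogeneity:

* `aaQuery_of_twoLevelDescentQ` — TWO-LEVEL DESCENT INSIDE `Q_T` ⟹ AA_Q (the hypothesis of
  `QTRestrict.quantumQuerySimulable_of_aaQuery`, hence AA14 Conjecture 4), constants
  `(c, C) = (2a, min(4/9, η²/16)·A²/B)`.

All base rungs used are proved (`oneQuery_influence`, `twoTopLevels_rung_robust`); the antecedent is the only open
piece.  Honest label: composition; the open piece is research-class (the tree's bounds stop at level `2T − 2`, where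
"remove" moves = repeated indices enter).

Sources: EscuderoGutierrez2023 (arXiv:2304.06713) Question 4.5, Remark 4.3; AaronsonAmbainis2014 Conj. 6 / Thm 7.
-/

noncomputable section

set_option linter.dupNamespace false

namespace Summit.QuantumAdvantage.QuantumAdvantage.Theorems.SosSandwich.QueryTopLevel

open Finset Literature.Computability.Cryptography Literature.Computability.QuantumComplexity
open Literature.Computability.Complexity.LowDegree

variable {N : ℕ}

/-- **Base rungs, two-level form**: a surrogate acceptance polynomial which is one-query, OR has `T' ≥ 2` queries and
a fraction `η` of its variance on Walsh levels `2T'−1, 2T'`, has a variable with `min(4/9, η²/16)·Var² ≤ Inf_i`.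
[cite: EscuderoGutierrez2023, Cor 1.7] -/
theorem baseClassQ2_influence (Q : QQueryAlg N) (q : MvPolynomial (Fin N) ℝ)
    (hq : ∀ x, evalBool q x = Q.acceptProb x) {η : ℝ} (hη : 0 ≤ η)
    (hbase : Q.queries = 1 ∨ (2 ≤ Q.queries ∧ η * boolVariance q ≤
      (∑ S ∈ Finset.univ.filter (fun S : Finset (Fin N) => S.card = 2 * Q.queries),
          cubeFourierCoeff (evalBool q) S ^ 2) +
        ∑ S ∈ Finset.univ.filter (fun S : Finset (Fin N) => S.card = 2 * Q.queries - 1),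
          cubeFourierCoeff (evalBool q) S ^ 2))
    (hv : 0 < boolVariance q) :
    ∃ i : Fin N, min (4 / 9 : ℝ) (η ^ 2 / 16) * boolVariance q ^ 2 ≤ influence i q := by
  have hsq : 0 ≤ boolVariance q ^ 2 := sq_nonneg _
  rcases hbase with h1 | ⟨h2, hmass⟩
  · obtain ⟨i, hi⟩ := oneQuery_influence Q h1 q hq hv
    refine ⟨i, ?_⟩
    calc min (4 / 9 : ℝ) (η ^ 2 / 16) * boolVariance q ^ 2 ≤ 4 / 9 * boolVariance q ^ 2 :=
          mul_le_mul_of_nonneg_right (min_le_left _ _) hsq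
      _ ≤ influence i q := by linarith
  · obtain ⟨i, hi⟩ := twoTopLevels_rung_robust Q h2 q hq hη hmass
    refine ⟨i, ?_⟩
    calc min (4 / 9 : ℝ) (η ^ 2 / 16) * boolVariance q ^ 2 ≤ η ^ 2 / 16 * boolVariance q ^ 2 :=
          mul_le_mul_of_nonneg_right (min_le_right _ _) hsq
      _ ≤ influence i q := by linarith

/-- **TWO-LEVEL DESCENT INSIDE `Q_T` IMPLIES AA_Q.**  If for some `η > 0` every `T`-query acceptance polynomial
`p` (`T ≥ 1`) with `Var[p] ≥ ε > 0` has a surrogate acceptance polynomial `q` of a `T'`-query algorithm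
(`1 ≤ T' ≤ T`) which is one-query OR has `T' ≥ 2` and `η·Var[q] ≤ W^{=2T'}[q] + W^{=2T'−1}[q]`, with
`Var[q] ≥ A(ε/T)^a` and every influence of `q` at most `B ×` some influence of `p`, then the Aaronson–Ambainis
bound holds for all quantum acceptance probabilities with `(c, C) = (2a, min(4/9, η²/16)·A²/B)`.
[cite: EscuderoGutierrez2023, Question 4.5] -/
theorem aaQuery_of_twoLevelDescentQ
    (hLD : ∃ (a : ℕ) (A B η : ℝ), 0 < A ∧ 0 < B ∧ 0 < η ∧
      ∀ (N : ℕ) (Q : QQueryAlg N) (p : MvPolynomial (Fin N) ℝ) (ε : ℝ),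
        1 ≤ Q.queries → (∀ x, evalBool p x = Q.acceptProb x) → 0 < ε → ε ≤ boolVariance p →
        ∃ (N' : ℕ) (Q' : QQueryAlg N') (q : MvPolynomial (Fin N') ℝ),
          1 ≤ Q'.queries ∧ Q'.queries ≤ Q.queries ∧ (∀ x, evalBool q x = Q'.acceptProb x) ∧
          (Q'.queries = 1 ∨ (2 ≤ Q'.queries ∧ η * boolVariance q ≤
            (∑ S ∈ Finset.univ.filter (fun S : Finset (Fin N') => S.card = 2 * Q'.queries),
                cubeFourierCoeff (evalBool q) S ^ 2) +
              ∑ S ∈ Finset.univ.filter (fun S : Finset (Fin N') => S.card = 2 * Q'.queries - 1),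
                cubeFourierCoeff (evalBool q) S ^ 2)) ∧
          A * (ε / Q.queries) ^ a ≤ boolVariance q ∧
          ∀ i : Fin N', ∃ i' : Fin N, influence i q ≤ B * influence i' p) :
    ∃ (c : ℕ) (C : ℝ), 0 < C ∧ ∀ (N : ℕ) (Q : QQueryAlg N) (p : MvPolynomial (Fin N) ℝ) (ε : ℝ),
      1 ≤ Q.queries → (∀ x, evalBool p x = Q.acceptProb x) → 0 < ε → ε ≤ boolVariance p →
        ∃ i : Fin N, C * (ε / Q.queries) ^ c ≤ influence i p := by
  obtain ⟨a, A, B, η, hA, hB, hη, hD⟩ := hLD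
  set κ : ℝ := min (4 / 9 : ℝ) (η ^ 2 / 16) with hκ
  have hκ0 : 0 < κ := lt_min (by norm_num) (by positivity)
  refine ⟨2 * a, κ * A ^ 2 / B, by positivity, fun N Q p ε hT hp hε hεv => ?_⟩
  obtain ⟨N', Q', q, hT'1, -, hq, hbase, hvar, hdom⟩ := hD N Q p ε hT hp hε hεv
  have hT0 : (0 : ℝ) < (Q.queries : ℝ) := by exact_mod_cast hT
  have hfloor : 0 < A * (ε / Q.queries) ^ a := mul_pos hA (pow_pos (div_pos hε hT0) a)
  have hvq : 0 < boolVariance q := lt_of_lt_of_le hfloor hvar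
  obtain ⟨i, hi⟩ := baseClassQ2_influence Q' q hq hη.le hbase hvq
  obtain ⟨i', hi'⟩ := hdom i
  refine ⟨i', ?_⟩
  have hsq_le : (A * (ε / Q.queries) ^ a) ^ 2 ≤ boolVariance q ^ 2 := pow_le_pow_left₀ hfloor.le hvar 2
  have step : κ * A ^ 2 * (ε / Q.queries) ^ (2 * a) ≤ B * influence i' p := by
    calc κ * A ^ 2 * (ε / Q.queries) ^ (2 * a)
        = κ * (A * (ε / Q.queries) ^ a) ^ 2 := by rw [pow_mul']; ring
      _ ≤ κ * boolVariance q ^ 2 := mul_le_mul_of_nonneg_left hsq_le hκ0.le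
      _ ≤ influence i q := hi
      _ ≤ B * influence i' p := hi'
  have hrew : κ * A ^ 2 / B * (ε / Q.queries) ^ (2 * a) = (κ * A ^ 2 * (ε / Q.queries) ^ (2 * a)) / B := by
    ring
  rw [hrew, div_le_iff₀ hB]
  linarith [step, mul_comm B (influence i' p)]


/-- **Second-highest level versus influence, all `T ≥ 1`.**  `∃ i, (W^{=2T−1}[p])² ≤ 4·Inf_i[p]` for every `T`-query
algorithm with `T ≥ 1` (for `T = 1` this follows from the one-query rung `4 Var² ≤ 9 maxInf`, as `W^{=1} ≤ Var`).
[cite: EscuderoGutierrez2023, Thm 1.6] -/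
theorem secondLevelWeight_sq_le_influence' (A : QQueryAlg N) (hT : 1 ≤ A.queries) (p : MvPolynomial (Fin N) ℝ)
    (hp : ∀ x, evalBool p x = A.acceptProb x) :
    ∃ i : Fin N, (∑ U ∈ Finset.univ.filter (fun U : Finset (Fin N) => U.card = 2 * A.queries - 1),
        cubeFourierCoeff (evalBool p) U ^ 2) ^ 2 ≤ 4 * influence i p := by
  by_cases h2 : 2 ≤ A.queries
  · exact secondLevelWeight_sq_le_influence A h2 p hp
  · have hT1 : A.queries = 1 := by omega
    set W := ∑ U ∈ Finset.univ.filter (fun U : Finset (Fin N) => U.card = 2 * A.queries - 1),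
        cubeFourierCoeff (evalBool p) U ^ 2
    have hW0 : 0 ≤ W := Finset.sum_nonneg fun U _ => sq_nonneg _
    -- `W ≤ Var`
    have hWV : W ≤ boolVariance p := by
      rw [boolVariance_eq_sum_sq_fourier]
      calc W ≤ ∑ U ∈ Finset.univ.filter (fun U : Finset (Fin N) => U.card = 2 * A.queries - 1),
            (if U = ∅ then 0 else cubeFourierCoeff (evalBool p) U ^ 2) := by
            refine Finset.sum_le_sum fun U hU => ?_
            rw [Finset.mem_filter] at hU
            have hU0 : U ≠ ∅ := by
              intro h; rw [h, Finset.card_empty] at hU; omega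
            rw [if_neg hU0]
        _ ≤ ∑ U, (if U = ∅ then 0 else cubeFourierCoeff (evalBool p) U ^ 2) :=
            Finset.sum_le_sum_of_subset_of_nonneg (Finset.filter_subset _ _) fun U _ _ => by
              split_ifs <;> positivity
    by_cases hv : boolVariance p = 0
    · have hW : W = 0 := le_antisymm (hv ▸ hWV) hW0
      refine ⟨A.start.1, ?_⟩
      rw [hW]
      have := influence_nonneg A.start.1 p
      nlinarith
    · have hvpos : 0 < boolVariance p := lt_of_le_of_ne (boolVariance_nonneg p) (Ne.symm hv)
      obtain ⟨i, hi⟩ := oneQuery_influence A hT1 p hp hvpos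
      refine ⟨i, ?_⟩
      have hI := influence_nonneg i p
      nlinarith [pow_le_pow_left₀ hW0 hWV 2]

end Summit.QuantumAdvantage.QuantumAdvantage.Theorems.SosSandwich.QueryTopLevel

end
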